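import Summits.RiemannHypothesis.RiemannHypothesis.Theorems.Splittings.LinearRayLehmerWindowDefs
import Summits.RiemannHypothesis.RiemannHypothesis.Theorems.UniversalFactorMediumHighCover

/-!
# The linear-factor ray at Lehmer's pair — soundness of the forward-average side

Cell rh-split (D-0116 arm), ENGINE 5 (rh-splitx-eng-5 g4), lane (xviii-D) «LEHMER WINDOW DATA», part Q.
For every `a` of a box `[A₁/AD, A₂/AD]` (`a₁ ≥ 1`) the rational `q = ldQ …` of the definitions file is a
lower bound of the forward average in the engine's units: `K₀ · q ≤ Q_a(x₀) = ∫₀^∞ H_0(x₀ + y) e^{−ay} dy`,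
`x₀ = 2t₀`, `K₀ = lehmerK0 t₀` (`ldQ_sound`: the `Q`-branch of the tree's `UniversalFactor.hiBoxCheck_sound`
— `hiSide_core` + `stub_highSideQ` + `stub_highTailQ` + `hiTails_sound` — with the margin returned instead
of sign-tested); `ldBoxCheck_sound` adds `0 ≤ q` and the margin `L·M < e^{−aL}·q` (`L = Ln/Ld`) from the
lower end of the interval exponential at `a₂`; `ldQRunWith_sound` covers a window by consecutive boxes.
HONEST LABEL: RH-free negative-side bookkeeping on the linear-factor ray (RH-strengthening via
`riemannHypothesis_of_exists_linearRay`); not a splitting; nothing here bears on the truth of RH.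
-/

set_option linter.dupNamespace false

noncomputable section

namespace Summit.RiemannHypothesis.RiemannHypothesis.Theorems.Splittings.LinearRayLehmerWindow

open Set MeasureTheory
open Literature.NumberTheory.LFunctions Literature.NumberTheory.LFunctions.ZetaNumerics
open Literature.Analysis.ValidatedNumerics Literature.Analysis.ValidatedNumerics.NumericsMP

/-- **Soundness of `ldQ`**: for every `a ∈ [A₁/AD, A₂/AD]` (`AD ≤ A₁`), `K₀ · q ≤ Q_a(x₀)`
(the `Q`-branch of the engine's `hiBoxCheck_sound`, margin returned). [folklore] -/
theorem ldQ_sound {C : UniversalFactor.LCtx} (hC : C.Valid) (hCt0 : C.t0 = UniversalFactor.lehmerT0)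
    {ρD CyB CyF : ℕ} {pt : UniversalFactor.HiPoint} (hpt : UniversalFactor.hiPointData C ρD CyB CyF = some pt)
    (hρ8 : 8 ≤ ρD) (hF : 2 * CyF ≤ 10 * ρD + 1) {A₁ A₂ AD : ℕ} (hAD : 0 < AD) (hA₁ : AD ≤ A₁)
    {q : ℚ} (h : ldQ C pt CyB CyF A₁ A₂ AD = some q) {a : ℝ} (h1 : (A₁ : ℝ) / AD ≤ a) (h2 : a ≤ (A₂ : ℝ) / AD) :
    UniversalFactor.lehmerK0 UniversalFactor.lehmerT0 * (q : ℝ) ≤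
      (∫ y in Ioi (0:ℝ), deBruijnH 0 (((2 * UniversalFactor.lehmerT0 : ℝ) : ℂ) + y) * (Real.exp (-(a * y)) : ℂ)).re := by
  have hS := hC.tv.S_pos
  have hSr : (0 : ℝ) < C.T.S := by exact_mod_cast hS
  have hρ : 0 < ρD := lt_of_lt_of_le (by norm_num) hρ8
  have hρr : (0 : ℝ) < ρD := by exact_mod_cast hρ
  have hADr : (0 : ℝ) < AD := by exact_mod_cast hAD
  have ha₁ : (1 : ℝ) ≤ (A₁ : ℝ) / AD := by rw [le_div_iff₀ hADr, one_mul]; exact_mod_cast hA₁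
  have ha1 : 1 ≤ a := ha₁.trans h1
  have ha0 : 0 < a := by linarith
  have hK := UniversalFactor.lehmerK0_pos UniversalFactor.lehmerT0
  set t₀ : ℝ := UniversalFactor.lehmerT0 with ht₀def
  have ht₀ : 7000 ≤ t₀ ∧ t₀ ≤ 7010 := by
    rw [ht₀def]; unfold UniversalFactor.lehmerT0 UniversalFactor.lehmerT0N UniversalFactor.lehmerT0D; norm_num
  obtain ⟨hptρ, -, hfwd, -⟩ := UniversalFactor.hiPointData_spec hpt
  unfold ldQ at h
  simp only at h
  split at h
  · rename_i EcB1 EcB2 EnB1 EnB2 EcF1 EcF2 EnF1 EnF2 eQ tP tQ htabs heQ htails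
    simp only [Option.some.injEq] at h
    rw [hptρ] at htabs heQ htails h
    unfold UniversalFactor.hiBoxTabs at htabs
    split at htabs
    · rename_i EcB1' EcB2' EnB1' EnB2' hEcB1 hEcB2 hEnB1 hEnB2
      split at htabs
      · rename_i EcF1' EcF2' EnF1' EnF2' hEcF1 hEcF2 hEnF1 hEnF2
        simp only [Option.some.injEq, Prod.mk.injEq] at htabs
        obtain ⟨⟨rfl, rfl, rfl, rfl⟩, ⟨rfl, rfl, rfl, rfl⟩⟩ := htabs
        obtain ⟨-, htQ⟩ := UniversalFactor.hiTails_sound hC hρ hAD hA₁ htails h1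
        have hcore := UniversalFactor.hiSide_core hC hCt0 hρ8 true hF hfwd hAD hEcF1 hEcF2 hEnF1 hEnF2 heQ h1 h2 (2 * a) rfl
        rw [← ht₀def] at hcore
        have hdec := UniversalFactor.stub_highSideQ t₀ a (1 / ρD) CyF ha0 (by positivity)
        have hcells : ∀ c : ℕ, t₀ + (2 * c + 1) * (1 / ρD) = UniversalFactor.hiCellT ρD true c := by
          intro c; rw [UniversalFactor.hiCellT_eq hρ, ← ht₀def]; simp; ring
        simp only [hcells] at hdec
        have htail := UniversalFactor.stub_highTailQ t₀ a (4 * (1 / ρD) * CyF) (by linarith [ht₀.1]) ha1 (by positivity)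
        have hre : |(∫ y in Ioi (4 * (1 / (ρD : ℝ)) * CyF),
            deBruijnH 0 (((2 * t₀ : ℝ) : ℂ) + y) * (Real.exp (-(a * y)) : ℂ)).re| ≤
            UniversalFactor.lehmerK0 t₀ * (tQ : ℝ) := by
          refine (Complex.abs_re_le_norm _).trans ((norm_integral_le_integral_norm _).trans (htail.trans ?_))
          refine mul_le_mul_of_nonneg_left ?_ hK.le
          have e : a * (4 * (1 / (ρD : ℝ)) * CyF) = a * (4 * CyF / ρD) := by ring
          rw [e]; exact htQ
        have hre' := (abs_le.1 hre).1
        set sh : ℝ := (((UniversalFactor.hiSideSum C.T.S ρD pt.fwd EnF1' EnF2' EcF1' EcF2' CyF).hi : ℤ) : ℝ) with hsh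
        have hq : (q : ℝ) = -(2 * (sh / (C.T.S : ℝ) + (eQ : ℝ)) + (tQ : ℝ)) := by
          rw [← h, hsh]; push_cast; ring
        have e2 : UniversalFactor.lehmerK0 t₀ * (-(2 * (sh / (C.T.S : ℝ) + (eQ : ℝ)) + (tQ : ℝ))) =
            2 * (-(UniversalFactor.lehmerK0 t₀ * (sh / (C.T.S : ℝ) + (eQ : ℝ)))) - UniversalFactor.lehmerK0 t₀ * (tQ : ℝ) := by
          ring
        rw [hdec, hq, e2]
        linarith [hcore, hre']
      · simp at htabs
    · simp at htabs
  · simp at h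

/-- **Soundness of `ldExpLo`**: `e/S ≤ e^{−a·(Ln/Ld)}` for every `a ≤ A₂/AD` (`AD, Ld > 0`). [folklore] -/
theorem ldExpLo_sound {S : ℕ} (hS : 0 < S) {A₂ AD Ln Ld : ℕ} (hAD : 0 < AD) (hLd : 0 < Ld) {e : ℤ}
    (h : ldExpLo S A₂ AD Ln Ld = some e) {a : ℝ} (h2 : a ≤ (A₂ : ℝ) / AD) :
    (e : ℝ) / S ≤ Real.exp (-(a * ((Ln : ℝ) / Ld))) := by
  unfold ldExpLo at h
  split at h
  · rename_i E hE
    simp only [Option.some.injEq] at h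
    subst h
    have hSr : (0 : ℝ) < S := by exact_mod_cast hS
    have hq : 0 < AD * Ld := Nat.mul_pos hAD hLd
    have hm := MI.mem_exp hS hE (MI.mem_ofFrac S (-(((A₂ * Ln : ℕ) : ℤ))) hq)
    have hlo := MI.lo_div_le hS hm
    refine hlo.trans (Real.exp_le_exp.2 ?_)
    have hADr : (0 : ℝ) < AD := by exact_mod_cast hAD
    have hLdr : (0 : ℝ) < Ld := by exact_mod_cast hLd
    have hLn : (0 : ℝ) ≤ Ln := by positivity
    have e1 : ((-((A₂ * Ln : ℕ) : ℤ) : ℤ) : ℝ) / ((AD * Ld : ℕ) : ℝ) = -(((A₂ : ℝ) / AD) * ((Ln : ℝ) / Ld)) := by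
      rw [Int.cast_neg, Int.cast_natCast, Nat.cast_mul, Nat.cast_mul, div_mul_div_comm, neg_div]
    rw [e1, neg_le_neg_iff]
    exact mul_le_mul_of_nonneg_right h2 (by positivity)
  · simp at h

/-- **Soundness of the box check**: for every `a ∈ [A₁/AD, A₂/AD]` there is a real `q ≥ 0` with
`K₀ · q ≤ Q_a(x₀)` and the margin `(Ln/Ld)·M < e^{−a·Ln/Ld}·q`. [folklore] -/
theorem ldBoxCheck_sound {C : UniversalFactor.LCtx} (hC : C.Valid) (hCt0 : C.t0 = UniversalFactor.lehmerT0)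
    {ρD CyB CyF : ℕ} {pt : UniversalFactor.HiPoint} (hpt : UniversalFactor.hiPointData C ρD CyB CyF = some pt)
    (hρ8 : 8 ≤ ρD) (hF : 2 * CyF ≤ 10 * ρD + 1) {A₁ A₂ AD Ln Ld : ℕ} (hAD : 0 < AD) (hA₁ : AD ≤ A₁) (hLd : 0 < Ld)
    {M : ℚ} (h : ldBoxCheck C pt CyB CyF A₁ A₂ AD Ln Ld M = true) {a : ℝ} (h1 : (A₁ : ℝ) / AD ≤ a) (h2 : a ≤ (A₂ : ℝ) / AD) :
    ∃ q : ℝ, 0 ≤ q ∧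
      UniversalFactor.lehmerK0 UniversalFactor.lehmerT0 * q ≤
        (∫ y in Ioi (0:ℝ), deBruijnH 0 (((2 * UniversalFactor.lehmerT0 : ℝ) : ℂ) + y) * (Real.exp (-(a * y)) : ℂ)).re ∧
      ((Ln : ℝ) / Ld) * (M : ℝ) < Real.exp (-(a * ((Ln : ℝ) / Ld))) * q := by
  have hS := hC.tv.S_pos
  have hSr : (0 : ℝ) < C.T.S := by exact_mod_cast hS
  unfold ldBoxCheck at h
  split at h
  · rename_i q e hq he
    simp only [Bool.and_eq_true, decide_eq_true_eq] at h
    obtain ⟨hq0, hmargin⟩ := h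
    refine ⟨(q : ℝ), by exact_mod_cast hq0, ldQ_sound hC hCt0 hpt hρ8 hF hAD hA₁ hq h1 h2, ?_⟩
    have hexp := ldExpLo_sound hS hAD hLd he h2
    have hm : ((Ln : ℝ) / Ld) * (M : ℝ) < ((e : ℝ) / C.T.S) * (q : ℝ) := by
      have h' := (Rat.cast_lt (K := ℝ)).2 hmargin
      push_cast at h'
      exact h'
    exact hm.trans_le (mul_le_mul_of_nonneg_right hexp (by exact_mod_cast hq0))
  · simp at h

/-- **Soundness of the window check**: a passing `ldQRunWith` on valid tables gives, for every `a` of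
the window `[As₀/AD, As_last/AD]`, a real `q ≥ 0` with `K₀ · q ≤ Q_a(x₀)` and
`(Ln/Ld)·M < e^{−a·Ln/Ld}·q`; moreover `0 ≤ M`. [folklore] -/
theorem ldQRunWith_sound {oT : Option Tables} (hT : ∀ T, oT = some T → T.Valid)
    {ρD CyB CyF : ℕ} {As : List ℕ} {AD Ln Ld : ℕ} {M : ℚ} (h : ldQRunWith oT ρD CyB CyF As AD Ln Ld M = true)
    {a : ℝ} (hlo : (As.getD 0 0 : ℝ) / AD ≤ a) (hhi : a ≤ (As.getD (As.length - 1) 0 : ℝ) / AD) :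
    0 ≤ M ∧ ∃ q : ℝ, 0 ≤ q ∧
      UniversalFactor.lehmerK0 UniversalFactor.lehmerT0 * q ≤
        (∫ y in Ioi (0:ℝ), deBruijnH 0 (((2 * UniversalFactor.lehmerT0 : ℝ) : ℂ) + y) * (Real.exp (-(a * y)) : ℂ)).re ∧
      ((Ln : ℝ) / Ld) * (M : ℝ) < Real.exp (-(a * ((Ln : ℝ) / Ld))) * q := by
  cases oT with
  | none => simp [ldQRunWith] at h
  | some T =>
    have hTv : T.Valid := hT T rfl
    unfold ldQRunWith at h
    dsimp only at h
    split at h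
    · simp at h
    · rename_i C hC
      obtain ⟨hCT, -, hN, hD⟩ := UniversalFactor.mkCtx_fields hC
      obtain ⟨h1, h2, h3, h4, h5, h6, h7⟩ := UniversalFactor.mkCtx_spec hTv hC
      have hCv : C.Valid := ⟨h1, h2, h3, h4, h5, h6, h7⟩
      have hCt0 : C.t0 = UniversalFactor.lehmerT0 := UniversalFactor.LCtx.t0_eq hN hD
      split at h
      · simp at h
      · rename_i pt hpt
        unfold ldCoverCheck at h
        simp only [Bool.and_eq_true, decide_eq_true_eq, List.all_eq_true, List.mem_range] at h
        obtain ⟨⟨hρ8, -, hF, hAD, hlen, hLd, hM⟩, hall⟩ := h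
        have hptρ := (UniversalFactor.hiPointData_spec hpt).1
        rw [hptρ] at hρ8 hF
        refine ⟨hM, ?_⟩
        obtain ⟨k, hk, hk1, hk2⟩ := UniversalFactor.osa_cover_find As AD a hlo (As.length - 1) (by omega) hhi
        obtain ⟨hA₁, hbox⟩ := hall k hk
        exact ldBoxCheck_sound hCv hCt0 hpt hρ8 hF hAD hA₁ hLd hbox hk1 hk2

end Summit.RiemannHypothesis.RiemannHypothesis.Theorems.Splittings.LinearRayLehmerWindow

end
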